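import Literature.MathematicalPhysics.QuantumManyBody.DirichletBoxParseval
import HarnessLib

/-!
# The free Dirichlet gap of a cube in the product sine basis

Topic `Literature/MathematicalPhysics/QuantumManyBody`, grouping namespace `DirichletBox`; second
part of `DirichletBoxParseval.lean` (Parseval `∑_k |⟨S_k, g⟩|² = ‖g‖²` and the form identity
`∑_k (π/ℓ)²|k|² |⟨S_k, g⟩|² = ∫|∇g|²` for the product SINE modes `S_k` of the cube `[0,ℓ]^{d+1}`
and `C¹` functions vanishing on its faces). Here:

* `gap_mul_lintegral_enorm_sq_le` — **the free Dirichlet gap** on `[0,ℓ]^{d+1}`: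
  `((d+1)+3)(π/ℓ)² ∫|g|² ≤ ∫ ∑ᵢ|∂ᵢg|² + 3(π/ℓ)² |⟨S_𝟙, g⟩|²`, `𝟙 = (1,…,1)`: the ground level
  `(d+1)π²/ℓ²` of the Dirichlet Laplacian is simple with eigenfunction `S_𝟙` and every other level is
  `≥ ((d+1)+3)π²/ℓ²` (one quantum `4 − 1 = 3` in units of `π²/ℓ²`) [LSSY2005, Ch. 2: ground state
  `3π²/ℓ²`, first excited state `6π²/ℓ²` for one particle in `ℝ³`];
* `gap_mul_lintegral_enorm_sq_le_pi` — the same over an arbitrary non-empty finite coordinate type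
  `ι` (transport along a relabelling `Fin (d+1) ≃ ι`, a measure-preserving linear isometry);
* `lintegral_enorm_sq_sub_inner_mul` — Pythagoras for the projection onto a normalised vector in
  `L²` of any measure space: `∫|u − ⟨v,u⟩v|² = 1 − |⟨v,u⟩|²` when `‖u‖ = ‖v‖ = 1` (used to turn the
  gap into a bound on the distance to the ground state, `FreeDirichletGap.lean`).

All statements in `ℝ≥0∞`; no definitions.

## References

* [LSSY2005] E. H. Lieb, R. Seiringer, J. P. Solovej, J. Yngvason, *The Mathematics of the Bose Gas
  and its Condensation*, Birkhäuser 2005: Ch. 2, (2.3) and after (2.50).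
-/

noncomputable section

open Real intervalIntegral MeasureTheory Set Filter Topology Complex
open scoped ENNReal NNReal ComplexConjugate

namespace Literature.MathematicalPhysics.QuantumManyBody.DirichletBox

open Literature.MathematicalPhysics.QuantumManyBody.NeumannBox

variable {d : ℕ} {ℓ : ℝ}

/-! ### The free Dirichlet gap of the cube -/

/-- A sine coefficient with a ZERO entry in its multi-index vanishes (the mode has the factor
`sin(0) = 0`). [folklore] -/
theorem sinCoef_eq_zero_of_apply_eq_zero {k : Fin (d + 1) → ℕ} {i : Fin (d + 1)} (hk : k i = 0)
    (g : (Fin (d + 1) → ℝ) → ℂ) :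
    ∫ y in Icc (0 : Fin (d + 1) → ℝ) (fun _ => ℓ),
        ((∏ j, Real.sqrt (2 / ℓ) * Real.sin (waveNumber ℓ (k j) * y j) : ℝ) : ℂ) * g y = 0 := by
  refine setIntegral_eq_zero_of_forall_eq_zero fun y _ => ?_
  rw [Finset.prod_eq_zero (Finset.mem_univ i) (by simp [hk, waveNumber]), Complex.ofReal_zero,
    zero_mul]

/-- For a multi-index of POSITIVE integers other than `𝟙 = (1,…,1)`, `∑ᵢ kᵢ² ≥ (d+1) + 3` on
`ℕ^{d+1}`: one entry is `≥ 2`. [folklore] -/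
theorem card_add_three_le_sum_sq {k : Fin (d + 1) → ℕ} (hpos : ∀ i, k i ≠ 0)
    (hne : k ≠ fun _ => 1) : ((d + 1 : ℕ) : ℝ) + 3 ≤ ∑ i, ((k i : ℝ)) ^ 2 := by
  obtain ⟨i, hi⟩ : ∃ i, k i ≠ 1 := by
    by_contra hall
    push Not at hall
    exact hne (funext hall)
  have hki : (2 : ℝ) ≤ k i := by
    have h1 := hpos i
    have : 2 ≤ k i := by omega
    exact_mod_cast this
  have hrest : ∀ j, (1 : ℝ) ≤ (k j : ℝ) ^ 2 := fun j => by
    have : (1 : ℝ) ≤ k j := by exact_mod_cast Nat.one_le_iff_ne_zero.2 (hpos j)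
    nlinarith
  have hsplit : ∑ j, ((k j : ℝ)) ^ 2 = (k i : ℝ) ^ 2 + ∑ j ∈ Finset.univ.erase i, ((k j : ℝ)) ^ 2 :=
    (Finset.add_sum_erase _ _ (Finset.mem_univ i)).symm
  have hcard : (Finset.univ.erase i).card = d := by
    rw [Finset.card_erase_of_mem (Finset.mem_univ i), Finset.card_univ, Fintype.card_fin]; omega
  have hsum_rest : (d : ℝ) ≤ ∑ j ∈ Finset.univ.erase i, ((k j : ℝ)) ^ 2 := by
    have := Finset.card_nsmul_le_sum (Finset.univ.erase i) (fun j => ((k j : ℝ)) ^ 2) 1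
      (fun j _ => hrest j)
    rw [hcard, nsmul_eq_mul, mul_one] at this
    exact this
  rw [hsplit]
  push_cast
  nlinarith

/-- **The free Dirichlet gap of the cube `[0,ℓ]^{d+1}`** (`ℝ≥0∞` form): for `g ∈ C¹(ℝ^{d+1})`
vanishing on every face of the cube and `ℓ > 0`,
`((d+1)+3)(π/ℓ)² ∫|g|² ≤ ∫ ∑ᵢ |∂ᵢ g|² + 3(π/ℓ)² |∫ S_𝟙 g|²`, `S_𝟙 = ∏ⱼ (2/ℓ)^{1/2} sin(πyⱼ/ℓ)`:
in the sine basis the form has eigenvalues `(π/ℓ)²|k|²`, `k ∈ ℕ₊^{d+1}`, the ground level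
`(d+1)π²/ℓ²` belongs to `k = 𝟙` alone and every other level is `≥ ((d+1)+3)π²/ℓ²` — the spectral
gap `3π²/ℓ²` of the free Dirichlet Laplacian ("the kinetic energy of a single particle in the
first excited state" minus the ground state). [cite: LSSY2005, Ch. 2, after (2.50)] -/
theorem gap_mul_lintegral_enorm_sq_le (hℓ : 0 < ℓ) {g : (Fin (d + 1) → ℝ) → ℂ}
    (hg : ContDiff ℝ 1 g)
    (hbd : ∀ (y : Fin (d + 1) → ℝ) (i : Fin (d + 1)), y i = 0 ∨ y i = ℓ → g y = 0) :
    ENNReal.ofReal ((((d + 1 : ℕ) : ℝ) + 3) * (π / ℓ) ^ 2) *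
        ∫⁻ y in Icc (0 : Fin (d + 1) → ℝ) (fun _ => ℓ), ‖g y‖ₑ ^ 2 ≤
      (∫⁻ y in Icc (0 : Fin (d + 1) → ℝ) (fun _ => ℓ), ∑ i, ‖fderiv ℝ g y (Pi.single i 1)‖ₑ ^ 2) +
        ENNReal.ofReal (3 * (π / ℓ) ^ 2) * ‖∫ y in Icc (0 : Fin (d + 1) → ℝ) (fun _ => ℓ),
          ((∏ j, Real.sqrt (2 / ℓ) * Real.sin (waveNumber ℓ 1 * y j) : ℝ) : ℂ) * g y‖ₑ ^ 2 := by
  -- everything in the sine basis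
  rw [← tsum_enorm_sq_sinCoef hℓ (d + 1) hg.continuous,
    ← tsum_sum_waveNumber_sq_mul_enorm_sq_sinCoef hℓ hg hbd, ← ENNReal.tsum_mul_left]
  set c : (Fin (d + 1) → ℕ) → ℝ≥0∞ := fun k => ‖∫ y in Icc (0 : Fin (d + 1) → ℝ) (fun _ => ℓ),
      ((∏ j, Real.sqrt (2 / ℓ) * Real.sin (waveNumber ℓ (k j) * y j) : ℝ) : ℂ) * g y‖ₑ ^ 2 with hc
  set one : Fin (d + 1) → ℕ := fun _ => 1 with hone
  have hrhs : (∑' k : Fin (d + 1) → ℕ, ENNReal.ofReal (∑ i, waveNumber ℓ (k i) ^ 2) * c k) +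
      ENNReal.ofReal (3 * (π / ℓ) ^ 2) * c one =
        ∑' k : Fin (d + 1) → ℕ, (ENNReal.ofReal (∑ i, waveNumber ℓ (k i) ^ 2) * c k +
          (if k = one then ENNReal.ofReal (3 * (π / ℓ) ^ 2) * c one else 0)) := by
    rw [ENNReal.tsum_add, tsum_ite_eq]
  show (∑' k : Fin (d + 1) → ℕ, ENNReal.ofReal ((((d + 1 : ℕ) : ℝ) + 3) * (π / ℓ) ^ 2) * c k) ≤
    (∑' k : Fin (d + 1) → ℕ, ENNReal.ofReal (∑ i, waveNumber ℓ (k i) ^ 2) * c k) +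
      ENNReal.ofReal (3 * (π / ℓ) ^ 2) * c one
  rw [hrhs]
  refine ENNReal.tsum_le_tsum fun k => ?_
  by_cases hk : k = one
  · -- the ground mode: equality
    subst hk
    rw [if_pos rfl, ← add_mul, ← ENNReal.ofReal_add (Finset.sum_nonneg fun i _ => sq_nonneg _)
      (by positivity)]
    refine mul_le_mul' (ENNReal.ofReal_le_ofReal (le_of_eq ?_)) le_rfl
    simp only [hone, waveNumber, Finset.sum_const, Finset.card_univ, Fintype.card_fin, nsmul_eq_mul,
      Nat.cast_one, one_mul]
    ring
  · rw [if_neg hk, add_zero]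
    by_cases hz : ∃ i, k i = 0
    · obtain ⟨i, hi⟩ := hz
      have : c k = 0 := by
        simp only [hc, sinCoef_eq_zero_of_apply_eq_zero hi g, enorm_zero, ne_eq, OfNat.ofNat_ne_zero,
          not_false_eq_true, zero_pow]
      simp [this]
    · push Not at hz
      refine mul_le_mul' (ENNReal.ofReal_le_ofReal ?_) le_rfl
      have hsum := card_add_three_le_sum_sq hz hk
      have hw : ∑ i, waveNumber ℓ (k i) ^ 2 = (π / ℓ) ^ 2 * ∑ i, ((k i : ℝ)) ^ 2 := by
        rw [Finset.mul_sum]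
        refine Finset.sum_congr rfl fun i _ => ?_
        simp only [waveNumber]; ring
      rw [hw]
      nlinarith [sq_nonneg (π / ℓ), hsum]

/-! ### The gap for an arbitrary finite coordinate type -/

/-- Relabelling the coordinates of `ℝ^{d+1}` along `σ : Fin (d+1) ≃ ι` (Mathlib's
`Equiv.piCongrLeft`), evaluated at `σ a`. [folklore] -/
theorem piCongrLeft_apply_equiv {ι : Type*} (σ : Fin (d + 1) ≃ ι) (y : Fin (d + 1) → ℝ)
    (a : Fin (d + 1)) : (Equiv.piCongrLeft (fun _ : ι => ℝ) σ y) (σ a) = y a :=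
  Equiv.piCongrLeft_apply_apply (P := fun _ : ι => ℝ) σ y a

/-- Relabelling the coordinates, evaluated at `b`. [folklore] -/
theorem piCongrLeft_apply' {ι : Type*} (σ : Fin (d + 1) ≃ ι) (y : Fin (d + 1) → ℝ) (b : ι) :
    (Equiv.piCongrLeft (fun _ : ι => ℝ) σ y) b = y (σ.symm b) := by
  conv_lhs => rw [← σ.apply_symm_apply b]
  exact piCongrLeft_apply_equiv σ y (σ.symm b)

/-- The relabelling sends the coordinate vector `e_a` to `e_{σ a}`. [folklore] -/
theorem piCongrLeft_single {ι : Type*} [DecidableEq ι] (σ : Fin (d + 1) ≃ ι) (a : Fin (d + 1)) :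
    Equiv.piCongrLeft (fun _ : ι => ℝ) σ (Pi.single a (1 : ℝ)) = Pi.single (σ a) 1 := by
  ext b
  rw [piCongrLeft_apply']
  by_cases h : b = σ a
  · subst h; simp
  · have h' : σ.symm b ≠ a := fun h'' => h (by rw [← h'', Equiv.apply_symm_apply])
    rw [Pi.single_eq_of_ne h', Pi.single_eq_of_ne h]

/-- The relabelling maps the cube onto the cube. [folklore] -/
theorem preimage_piCongrLeft_Icc {ι : Type*} (σ : Fin (d + 1) ≃ ι) (ℓ : ℝ) :
    (Equiv.piCongrLeft (fun _ : ι => ℝ) σ) ⁻¹' (Icc (0 : ι → ℝ) fun _ => ℓ) =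
      Icc (0 : Fin (d + 1) → ℝ) fun _ => ℓ := by
  ext y
  simp only [Set.mem_preimage, Set.mem_Icc, Pi.le_def, Pi.zero_apply]
  constructor
  · rintro ⟨h0, h1⟩
    exact ⟨fun a => by simpa only [piCongrLeft_apply_equiv] using h0 (σ a),
      fun a => by simpa only [piCongrLeft_apply_equiv] using h1 (σ a)⟩
  · rintro ⟨h0, h1⟩
    exact ⟨fun b => by rw [piCongrLeft_apply']; exact h0 _,
      fun b => by rw [piCongrLeft_apply']; exact h1 _⟩

/-- **The free Dirichlet gap of the cube `[0,ℓ]^ι`** over an arbitrary non-empty finite coordinate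
type `ι` (`ℝ≥0∞` form): for `f ∈ C¹(ℝ^ι)` vanishing on every face of the cube and `ℓ > 0`,
`(|ι|+3)(π/ℓ)² ∫|f|² ≤ ∫ ∑ᵢ |∂ᵢ f|² + 3(π/ℓ)² |∫ S_𝟙 f|²` — transported from `Fin (d+1)` along a
relabelling of the coordinates (a measure-preserving linear isometry).
[cite: LSSY2005, Ch. 2, after (2.50)] -/
theorem gap_mul_lintegral_enorm_sq_le_pi {ι : Type*} [Fintype ι] [DecidableEq ι] [Nonempty ι]
    (hℓ : 0 < ℓ) {f : (ι → ℝ) → ℂ} (hf : ContDiff ℝ 1 f)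
    (hbd : ∀ (z : ι → ℝ) (b : ι), z b = 0 ∨ z b = ℓ → f z = 0) :
    ENNReal.ofReal ((((Fintype.card ι : ℕ) : ℝ) + 3) * (π / ℓ) ^ 2) *
        ∫⁻ z in Icc (0 : ι → ℝ) (fun _ => ℓ), ‖f z‖ₑ ^ 2 ≤
      (∫⁻ z in Icc (0 : ι → ℝ) (fun _ => ℓ), ∑ b, ‖fderiv ℝ f z (Pi.single b 1)‖ₑ ^ 2) +
        ENNReal.ofReal (3 * (π / ℓ) ^ 2) * ‖∫ z in Icc (0 : ι → ℝ) (fun _ => ℓ),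
          ((∏ b, Real.sqrt (2 / ℓ) * Real.sin (waveNumber ℓ 1 * z b) : ℝ) : ℂ) * f z‖ₑ ^ 2 := by
  -- relabel the coordinates by `Fin (d+1)`
  obtain ⟨d, hd⟩ : ∃ d : ℕ, Fintype.card ι = d + 1 :=
    ⟨Fintype.card ι - 1, (Nat.succ_pred_eq_of_pos Fintype.card_pos).symm⟩
  set σ : Fin (d + 1) ≃ ι := (finCongr hd.symm).trans (Fintype.equivFin ι).symm with hσ
  set E : (Fin (d + 1) → ℝ) ≃L[ℝ] (ι → ℝ) := ContinuousLinearEquiv.piCongrLeft ℝ (fun _ : ι => ℝ) σ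
    with hE
  set e : (Fin (d + 1) → ℝ) ≃ᵐ (ι → ℝ) := MeasurableEquiv.piCongrLeft (fun _ : ι => ℝ) σ with he
  have hEe : ∀ y, E y = e y := fun y => rfl
  have hEq : ∀ y, (E y : ι → ℝ) = Equiv.piCongrLeft (fun _ : ι => ℝ) σ y := fun y => rfl
  have hmp : MeasurePreserving e volume volume := volume_measurePreserving_piCongrLeft _ σ
  have hpre : e ⁻¹' (Icc (0 : ι → ℝ) fun _ => ℓ) = Icc (0 : Fin (d + 1) → ℝ) fun _ => ℓ :=
    preimage_piCongrLeft_Icc σ ℓ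
  -- the pulled-back function
  set g : (Fin (d + 1) → ℝ) → ℂ := fun y => f (E y) with hg
  have hgC : ContDiff ℝ 1 g := hf.comp E.contDiff
  have hgbd : ∀ (y : Fin (d + 1) → ℝ) (i : Fin (d + 1)), y i = 0 ∨ y i = ℓ → g y = 0 := by
    intro y i hy
    refine hbd (E y) (σ i) ?_
    rwa [hEq, piCongrLeft_apply_equiv]
  have key := gap_mul_lintegral_enorm_sq_le hℓ hgC hgbd
  -- transport the three terms
  have hmass : ∫⁻ y in Icc (0 : Fin (d + 1) → ℝ) (fun _ => ℓ), ‖g y‖ₑ ^ 2 =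
      ∫⁻ z in Icc (0 : ι → ℝ) (fun _ => ℓ), ‖f z‖ₑ ^ 2 := by
    rw [← hpre]
    exact hmp.setLIntegral_comp_preimage_emb e.measurableEmbedding (fun z => ‖f z‖ₑ ^ 2) _
  have hderiv : ∀ (y : Fin (d + 1) → ℝ) (i : Fin (d + 1)),
      fderiv ℝ g y (Pi.single i 1) = fderiv ℝ f (E y) (Pi.single (σ i) 1) := by
    intro y i
    have : g = f ∘ ⇑E := rfl
    rw [this, ContinuousLinearEquiv.comp_right_fderiv, ContinuousLinearMap.comp_apply]
    congr 1
    exact piCongrLeft_single σ i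
  have hkin : ∫⁻ y in Icc (0 : Fin (d + 1) → ℝ) (fun _ => ℓ), ∑ i, ‖fderiv ℝ g y (Pi.single i 1)‖ₑ ^ 2 =
      ∫⁻ z in Icc (0 : ι → ℝ) (fun _ => ℓ), ∑ b, ‖fderiv ℝ f z (Pi.single b 1)‖ₑ ^ 2 := by
    have h1 : ∀ y : Fin (d + 1) → ℝ, ∑ i, ‖fderiv ℝ g y (Pi.single i 1)‖ₑ ^ 2 =
        (fun z : ι → ℝ => ∑ b, ‖fderiv ℝ f z (Pi.single b 1)‖ₑ ^ 2) (e y) := by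
      intro y
      simp only [hderiv]
      rw [← hEe]
      exact Equiv.sum_comp σ (fun b => ‖fderiv ℝ f (E y) (Pi.single b 1)‖ₑ ^ 2)
    simp_rw [h1]
    rw [← hpre]
    exact hmp.setLIntegral_comp_preimage_emb e.measurableEmbedding
      (fun z : ι → ℝ => ∑ b, ‖fderiv ℝ f z (Pi.single b 1)‖ₑ ^ 2) _
  have hcoef : ∫ y in Icc (0 : Fin (d + 1) → ℝ) (fun _ => ℓ),
      ((∏ j, Real.sqrt (2 / ℓ) * Real.sin (waveNumber ℓ 1 * y j) : ℝ) : ℂ) * g y =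
        ∫ z in Icc (0 : ι → ℝ) (fun _ => ℓ),
          ((∏ b, Real.sqrt (2 / ℓ) * Real.sin (waveNumber ℓ 1 * z b) : ℝ) : ℂ) * f z := by
    have h1 : ∀ y : Fin (d + 1) → ℝ,
        ((∏ j, Real.sqrt (2 / ℓ) * Real.sin (waveNumber ℓ 1 * y j) : ℝ) : ℂ) * g y =
          (fun z : ι → ℝ => ((∏ b, Real.sqrt (2 / ℓ) * Real.sin (waveNumber ℓ 1 * z b) : ℝ) : ℂ) *
            f z) (e y) := by
      intro y
      simp only [hg, hEe]
      congr 2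
      rw [← Equiv.prod_comp σ (fun b => Real.sqrt (2 / ℓ) * Real.sin (waveNumber ℓ 1 * (e y) b))]
      refine Finset.prod_congr rfl fun a _ => ?_
      rw [← hEe, hEq, piCongrLeft_apply_equiv]
    simp_rw [h1]
    rw [← hpre]
    exact hmp.setIntegral_preimage_emb e.measurableEmbedding
      (fun z : ι → ℝ => ((∏ b, Real.sqrt (2 / ℓ) * Real.sin (waveNumber ℓ 1 * z b) : ℝ) : ℂ) * f z) _
  rw [hmass, hkin, hcoef] at key
  rw [hd]
  exact key


/-! ### Pythagoras for the projection onto a normalised vector (`L²` of any measure space) -/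

/-- `‖a − αb‖² = ‖a‖² + ‖α‖²‖b‖² − 2 Re(ᾱ b̄ a)` in `ℂ`. [folklore] -/
theorem norm_sub_mul_sq (a b α : ℂ) :
    ‖a - α * b‖ ^ 2 = ‖a‖ ^ 2 + ‖α‖ ^ 2 * ‖b‖ ^ 2 - 2 * (conj α * (conj b * a)).re := by
  simp only [Complex.sq_norm, Complex.normSq_apply, Complex.sub_re, Complex.sub_im, Complex.mul_re,
    Complex.mul_im, Complex.conj_re, Complex.conj_im]
  ring

/-- Integrability of `‖f‖²` from a finite `∫ ‖f‖²` (real form of `L²` membership). [folklore] -/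
theorem integrable_norm_sq_of_lintegral {X : Type*} [MeasurableSpace X] {μ : Measure X} {f : X → ℂ}
    (hf : AEStronglyMeasurable f μ) (h : ∫⁻ x, ‖f x‖ₑ ^ 2 ∂μ ≠ ⊤) :
    Integrable (fun x => ‖f x‖ ^ 2) μ := by
  refine ⟨by fun_prop, ?_⟩
  rw [hasFiniteIntegral_iff_enorm]
  have : ∀ x, ‖‖f x‖ ^ 2‖ₑ = ‖f x‖ₑ ^ 2 := fun x => by
    rw [Real.enorm_eq_ofReal (sq_nonneg _), ← ofReal_norm, ENNReal.ofReal_pow (norm_nonneg _)]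
  simp_rw [this]
  exact h.lt_top

/-- **Pythagoras for the projection onto a normalised vector**, `L²` form over any measure space:
if `∫|u|² = ∫|v|² = 1` and `α = ∫ v̄ u`, then `∫ |u − αv|² = 1 − |α|²` (in particular `|α| ≤ 1`,
Cauchy–Schwarz). [folklore] -/
theorem lintegral_enorm_sq_sub_inner_mul {X : Type*} [MeasurableSpace X] {μ : Measure X}
    {u v : X → ℂ} (hu : AEStronglyMeasurable u μ) (hv : AEStronglyMeasurable v μ)
    (hu1 : ∫⁻ x, ‖u x‖ₑ ^ 2 ∂μ = 1) (hv1 : ∫⁻ x, ‖v x‖ₑ ^ 2 ∂μ = 1) :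
    ∫⁻ x, ‖u x - (∫ y, conj (v y) * u y ∂μ) * v x‖ₑ ^ 2 ∂μ =
        ENNReal.ofReal (1 - ‖∫ y, conj (v y) * u y ∂μ‖ ^ 2) ∧
      ‖∫ y, conj (v y) * u y ∂μ‖ ^ 2 ≤ 1 := by
  set α : ℂ := ∫ y, conj (v y) * u y ∂μ with hα
  -- integrability
  have hu2 : Integrable (fun x => ‖u x‖ ^ 2) μ := integrable_norm_sq_of_lintegral hu (by rw [hu1]; simp)
  have hv2 : Integrable (fun x => ‖v x‖ ^ 2) μ := integrable_norm_sq_of_lintegral hv (by rw [hv1]; simp)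
  have hcross : Integrable (fun x => conj (v x) * u x) μ := by
    refine Integrable.mono' (hu2.add hv2) (by fun_prop) (ae_of_all _ fun x => ?_)
    rw [norm_mul, Complex.norm_conj]
    simp only [Pi.add_apply]
    nlinarith [sq_nonneg (‖v x‖ - ‖u x‖)]
  have hdiff : Integrable (fun x => ‖u x - α * v x‖ ^ 2) μ := by
    refine Integrable.mono' ((hu2.const_mul 2).add (hv2.const_mul (2 * ‖α‖ ^ 2))) (by fun_prop)
      (ae_of_all _ fun x => ?_)
    rw [Real.norm_of_nonneg (sq_nonneg _)]
    simp only [Pi.add_apply]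
    have h1 : ‖u x - α * v x‖ ≤ ‖u x‖ + ‖α‖ * ‖v x‖ := by
      calc ‖u x - α * v x‖ ≤ ‖u x‖ + ‖α * v x‖ := norm_sub_le _ _
        _ = ‖u x‖ + ‖α‖ * ‖v x‖ := by rw [norm_mul]
    have h0 : 0 ≤ ‖u x - α * v x‖ := norm_nonneg _
    nlinarith [sq_nonneg (‖u x‖ - ‖α‖ * ‖v x‖), norm_nonneg (u x), norm_nonneg α, norm_nonneg (v x),
      mul_nonneg (norm_nonneg α) (norm_nonneg (v x))]
  -- the real integrals
  have hIu : ∫ x, ‖u x‖ ^ 2 ∂μ = 1 := by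
    rw [integral_eq_lintegral_of_nonneg_ae (ae_of_all _ fun x => sq_nonneg _) (by fun_prop)]
    simp_rw [← ofReal_norm, ← ENNReal.ofReal_pow (norm_nonneg _)] at hu1
    have : ∫⁻ x, ENNReal.ofReal (‖u x‖ ^ 2) ∂μ = 1 := hu1
    rw [this, ENNReal.toReal_one]
  have hIv : ∫ x, ‖v x‖ ^ 2 ∂μ = 1 := by
    rw [integral_eq_lintegral_of_nonneg_ae (ae_of_all _ fun x => sq_nonneg _) (by fun_prop)]
    simp_rw [← ofReal_norm, ← ENNReal.ofReal_pow (norm_nonneg _)] at hv1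
    have : ∫⁻ x, ENNReal.ofReal (‖v x‖ ^ 2) ∂μ = 1 := hv1
    rw [this, ENNReal.toReal_one]
  have hIcross : ∫ x, (conj α * (conj (v x) * u x)).re ∂μ = ‖α‖ ^ 2 := by
    have h1 := Complex.reCLM.integral_comp_comm (hcross.const_mul (conj α))
    simp only [Complex.reCLM_apply] at h1
    rw [h1, MeasureTheory.integral_const_mul, ← hα, Complex.conj_mul', ← Complex.ofReal_pow,
      Complex.ofReal_re]
  have hre_int : Integrable (fun x => (conj α * (conj (v x) * u x)).re) μ := by
    have h1 := Complex.reCLM.integrable_comp (hcross.const_mul (conj α))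
    simpa only [Complex.reCLM_apply] using h1
  have hreal : ∫ x, ‖u x - α * v x‖ ^ 2 ∂μ = 1 - ‖α‖ ^ 2 := by
    have hpt : (fun x => ‖u x - α * v x‖ ^ 2) =
        fun x => (‖u x‖ ^ 2 + ‖α‖ ^ 2 * ‖v x‖ ^ 2) - 2 * (conj α * (conj (v x) * u x)).re := by
      funext x; exact norm_sub_mul_sq (u x) (v x) α
    have hf1 : Integrable (fun x => ‖u x‖ ^ 2 + ‖α‖ ^ 2 * ‖v x‖ ^ 2) μ := hu2.add (hv2.const_mul _)
    have hf2 : Integrable (fun x => 2 * (conj α * (conj (v x) * u x)).re) μ := hre_int.const_mul 2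
    rw [hpt, integral_sub hf1 hf2, integral_add hu2 (hv2.const_mul _), MeasureTheory.integral_const_mul,
      MeasureTheory.integral_const_mul, hIu, hIv, hIcross]
    ring
  have hnn : 0 ≤ 1 - ‖α‖ ^ 2 := by
    rw [← hreal]; exact integral_nonneg fun x => sq_nonneg _
  have hlin : ∫⁻ x, ‖u x - α * v x‖ₑ ^ 2 ∂μ = ENNReal.ofReal (∫ x, ‖u x - α * v x‖ ^ 2 ∂μ) := by
    rw [ofReal_integral_eq_lintegral_ofReal hdiff (ae_of_all _ fun x => sq_nonneg _)]
    congr 1; funext x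
    rw [← ofReal_norm, ENNReal.ofReal_pow (norm_nonneg _)]
  exact ⟨by rw [hlin, hreal], by linarith⟩

end Literature.MathematicalPhysics.QuantumManyBody.DirichletBox

end
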